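import Mathlib.RingTheory.Discriminant
import Mathlib.RingTheory.Norm.Defs
import HarnessLib

/-!
# The transfer determinant: `det Tr_{L/K}(α · x · y) = disc(L/K) · N_{L/K}(α)` (WEIL-2 gen 36, CYCLIC-G36 §1, fact-free core)

research route, not a corollary; conditional on HC_CM plus one named minimal statement.

Cell `pub-hodge-ring2-ab-*` (ALL ABELIAN VARIETIES), seat WEIL-2 gen 36, account
`run/shared/lean/pub/pub-hodge-ring2/pub-hodge-ring2-ab-weil-2/CYCLIC-G36.md` §1 (THEOREM C, the cyclic transfer law).

Informal setting.  For the metacyclic group `G = ℤ/f ⋊ H` (`H = ker χ_K`, `K = ℚ(ζ_f)^H` imaginary quadratic) and the induced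
representation `τ = Ind ψ`, the `τ`-piece of a `G`-cover INDUCED from a `μ_f`-cover `S` is the restriction of scalars, from
`L = ℚ(ζ_f)` to `K`, of the `ψ`-eigenspace `(U, h_U)` of `H¹(S)`, and its `K`-hermitian form is the transfer `Tr_{L/K} ∘ (θ_K h_U)`
(THEOREM C (i), Frobenius reciprocity).  The discriminant of a transferred form is governed by the identity of this file: for a
finite free extension `L/K` with basis `b`, the Gram matrix of the twisted trace form `(x, y) ↦ Tr_{L/K}(x · α · y)` is
`traceMatrix(b) · M_α` (`M_α` = the matrix of multiplication by `α`), so its determinant is `discr_K(b) · N_{L/K}(α)`; for an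
orthogonal sum `⊥_k ⟨α_k⟩` it is `discr_K(b)^d · N_{L/K}(∏ α_k)`, and the factor `discr_K(b)^d` is a square as soon as `d` is even
(THEOREM C (ii): `Λ_G(ι_* 𝔞) = [ |N_{L/K} det_L A(𝔞)| ]` on even `L`-rank, no frame constant).  The hermitian version used in the
account is the same computation with `σ(e_i) \overline{σ(e_j)}`; this file proves the bilinear identity over an arbitrary
commutative base, which is its algebraic content.

0 sorry, no `def`, no named fact; `HC_CM` does not occur.
-/

open Matrix

namespace Summit.HodgeConjecture.Ring2AbelianAll.CyclicTransferDeterminant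

variable {K L ι : Type*} [CommRing K] [CommRing L] [Algebra K L] [Fintype ι] [DecidableEq ι]

/-- The Gram matrix of the twisted trace form `(x, y) ↦ Tr_{L/K}(x · (α · y))` in a basis `b` is the trace matrix of `b`
times the matrix of multiplication by `α`.  [locator CYCLIC-G36 §1 (C1)]
research route, not a corollary; conditional on HC_CM plus one named minimal statement. -/
theorem twistedTraceMatrix_eq_traceMatrix_mul_leftMulMatrix (b : Module.Basis ι K L) (α : L) :
    (Matrix.of fun i j => Algebra.trace K L (b i * (α * b j))) =
      Algebra.traceMatrix K b * Algebra.leftMulMatrix b α := by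
  ext i j
  simp only [Matrix.of_apply, Matrix.mul_apply, Algebra.traceMatrix_apply, Algebra.traceForm_apply,
    Algebra.leftMulMatrix_eq_repr_mul]
  conv_lhs => rw [← b.sum_repr (α * b j)]
  rw [Finset.mul_sum, map_sum]
  refine Finset.sum_congr rfl fun k _ => ?_
  rw [mul_smul_comm, LinearMap.map_smul, smul_eq_mul, mul_comm]

/-- **The transfer determinant.**  `det (Tr_{L/K}(b_i · α · b_j))_{ij} = discr_K(b) · N_{L/K}(α)`.
[locator CYCLIC-G36 §1 (C1)]  research route, not a corollary; conditional on HC_CM plus one named minimal statement. -/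
theorem det_twistedTraceMatrix (b : Module.Basis ι K L) (α : L) :
    (Matrix.of fun i j => Algebra.trace K L (b i * (α * b j))).det =
      Algebra.discr K b * Algebra.norm K α := by
  rw [twistedTraceMatrix_eq_traceMatrix_mul_leftMulMatrix, Matrix.det_mul, Algebra.discr_def,
    Algebra.norm_eq_matrix_det b]

/-- Untwisted case (`α = 1`): the Gram determinant of the trace form itself is the discriminant `D_{L/K}(b)`.
[locator CYCLIC-G36 §1 (C1)]  research route, not a corollary; conditional on HC_CM plus one named minimal statement. -/
theorem det_traceMatrix_eq_discr (b : Module.Basis ι K L) :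
    (Matrix.of fun i j => Algebra.trace K L (b i * ((1 : L) * b j))).det = Algebra.discr K b := by
  rw [det_twistedTraceMatrix, map_one, mul_one]

/-- A scalar twist `α = a ∈ K` contributes `a^{[L:K]}`: `det (Tr(b_i · a · b_j)) = discr_K(b) · a^{[L:K]}` — a SQUARE factor
whenever `[L:K] = |H|` is even (the `θ_K`-twist of THEOREM C is invisible on the groups with `|H|` even).
[locator CYCLIC-G36 §1 (C1)/(C2)]  research route, not a corollary; conditional on HC_CM plus one named minimal statement. -/
theorem det_twistedTraceMatrix_algebraMap (b : Module.Basis ι K L) (a : K) :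
    (Matrix.of fun i j => Algebra.trace K L (b i * (algebraMap K L a * b j))).det =
      Algebra.discr K b * a ^ Fintype.card ι := by
  rw [det_twistedTraceMatrix, Algebra.norm_algebraMap_of_basis b]

variable {κ : Type*} [Fintype κ] [DecidableEq κ]

/-- **Transfer of an orthogonal sum.**  For a diagonal `L`-form `⊥_k ⟨α_k⟩` (`k ∈ κ`, `d = |κ|`) the transferred `K`-form has the
block-diagonal Gram matrix with blocks `(Tr(b_i α_k b_j))`, hence determinant `discr_K(b)^d · N_{L/K}(∏_k α_k)`
(THEOREM C (ii): `det_K Tr_{L/K}(h) = D_{L/K}^d · N_{L/K}(det_L h)`).  [locator CYCLIC-G36 §1 (C2)]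
research route, not a corollary; conditional on HC_CM plus one named minimal statement. -/
theorem det_blockDiagonal_twistedTraceMatrix (b : Module.Basis ι K L) (α : κ → L) :
    (Matrix.blockDiagonal fun k => Matrix.of fun i j => Algebra.trace K L (b i * (α k * b j))).det =
      Algebra.discr K b ^ Fintype.card κ * Algebra.norm K (∏ k, α k) := by
  rw [Matrix.det_blockDiagonal, map_prod]
  simp_rw [det_twistedTraceMatrix]
  rw [Finset.prod_mul_distrib, Finset.prod_const, Finset.card_univ]

/-- **Even rank kills the frame.**  If `d = |κ|` is even, the transferred determinant is `N_{L/K}(det_L h)` times a SQUARE of `K`: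
on even `L`-rank the discriminant class of the transferred form is the norm of the `L`-discriminant, with no dependence on the
basis / the field discriminant `D_{L/K}` (THEOREM C (ii), the even-rank law `Λ_G(ι_*𝔞) = [|N_{L/K} det A(𝔞)|]`).
[locator CYCLIC-G36 §1 (C2)]  research route, not a corollary; conditional on HC_CM plus one named minimal statement. -/
theorem det_blockDiagonal_twistedTraceMatrix_of_even (b : Module.Basis ι K L) (α : κ → L)
    (hκ : Even (Fintype.card κ)) :
    ∃ c : K, (Matrix.blockDiagonal fun k => Matrix.of fun i j => Algebra.trace K L (b i * (α k * b j))).det =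
      c ^ 2 * Algebra.norm K (∏ k, α k) := by
  obtain ⟨m, hm⟩ := hκ
  refine ⟨Algebra.discr K b ^ m, ?_⟩
  rw [det_blockDiagonal_twistedTraceMatrix, hm, ← two_mul, pow_mul']


/-! ### The interval Gram determinant (LEMMA AK′ of the account)

For the `μ_f`-cover with exponents `a_1, …, a_m` at the finite branch points (and `−Σ a_j` at `∞`) the Gram matrix of the
`ψ`-eigenform in the interval basis is the tridiagonal matrix of [Aomoto–Kita, *Theory of Hypergeometric Functions*, §2.3.3]
with `c_j = ζ^{a_j}`: diagonal `−(c_j c_{j+1} − 1)/((c_j − 1)(c_{j+1} − 1))`, off-diagonal `1/(c_{j+1} − 1)`, `c_{j+1}/(c_{j+1} − 1)`.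
Its determinant is `(−1)^{m−1} (c_1 ⋯ c_m − 1)/∏ (c_j − 1)` (induction on `m`); the two statements below are the rank-2 case
(four branch points — the first even-rank data) and the polynomial identity that IS the induction step.

Source of the matrix: [cite: AomotoKita2011, §2.3.3 pp. 52–53] («Intersection Number (i)», the displayed intersection matrix of
the regularised interval cycles `Δ_j(ω)` against `Δ_k`; `= [Kita–Yoshida, Math. Nachr. 166 (1994)]` for rank one).  The book's
case-list line prints `−1/d_k` for the super-diagonal entry — a sign misprint inconsistent with its own display; the displayed
sign (used here) is the skew-hermitian one and is re-derived from first principles, without the book, in the sequel account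
CIRCLE-G37 §1 (local intersection formula in the sheet model).  The theorems of this file are self-contained identities and do
not depend on the citation. -/

section continuant

variable {F : Type*} [Field F]

/-- **Induction step of LEMMA AK′** (continuant recurrence `D_{m+1} = A_{mm} D_m − A_{m−1,m} A_{m,m−1} D_{m−1}` cleared of
denominators): with `P = c_1 ⋯ c_{m−1}`, `a = c_m`, `b = c_{m+1}`.  [locator CYCLIC-G36 §2 LEMMA AK′]
research route, not a corollary; conditional on HC_CM plus one named minimal statement. -/
theorem continuant_step {R : Type*} [CommRing R] (a b P : R) :
    (a * b - 1) * (P * a - 1) - a * (b - 1) * (P - 1) = (a - 1) * (P * a * b - 1) := by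
  ring

/-- **LEMMA AK′, rank 2** (four branch points): the determinant of the `2 × 2` interval Gram matrix is
`(c₁ c₂ c₃ − 1)/((c₁ − 1)(c₂ − 1)(c₃ − 1))`.  [locator CYCLIC-G36 §2 LEMMA AK′]
research route, not a corollary; conditional on HC_CM plus one named minimal statement. -/
theorem det_intervalGram_two (c₁ c₂ c₃ : F) (h₁ : c₁ ≠ 1) (h₂ : c₂ ≠ 1) (h₃ : c₃ ≠ 1) :
    (!![-(c₁ * c₂ - 1) / ((c₁ - 1) * (c₂ - 1)), 1 / (c₂ - 1);
        c₂ / (c₂ - 1), -(c₂ * c₃ - 1) / ((c₂ - 1) * (c₃ - 1))] : Matrix (Fin 2) (Fin 2) F).det =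
      (c₁ * c₂ * c₃ - 1) / ((c₁ - 1) * (c₂ - 1) * (c₃ - 1)) := by
  have h₁' : c₁ - 1 ≠ 0 := sub_ne_zero.mpr h₁
  have h₂' : c₂ - 1 ≠ 0 := sub_ne_zero.mpr h₂
  have h₃' : c₃ - 1 ≠ 0 := sub_ne_zero.mpr h₃
  rw [Matrix.det_fin_two_of]
  field_simp
  ring

/-- **LEMMA AK′, rank 1** (three branch points): the single Gram entry `−(c₁c₂ − 1)/((c₁ − 1)(c₂ − 1))` equals, after the
substitution `c₁ c₂ = c_∞^{-1}`, the product form `−(1 − c_∞^{-1})·…`; recorded as the identity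
`(c₁c₂ − 1)·(c̄₁ − 1)(c̄₂ − 1) = (c₁ c₂ − 1)(1 − c₁)(1 − c₂)/(c₁ c₂)` for unit-modulus `c_j` (`c̄_j = c_j⁻¹`), i.e. the Gram entry is
`∏_j (1 − c_j^{-1})` up to the positive factor `|(c₁−1)(c₂−1)|²` — the shape `∏_j (1 − ζ^{−a_j})` of THEOREM C (iii).
[locator CYCLIC-G36 §2]  research route, not a corollary; conditional on HC_CM plus one named minimal statement. -/
theorem intervalGram_one_mul_conj (c₁ c₂ : F) (h₁ : c₁ ≠ 0) (h₂ : c₂ ≠ 0) :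
    (c₁ * c₂ - 1) * ((c₁⁻¹ - 1) * (c₂⁻¹ - 1)) = (c₁ * c₂ - 1) * (1 - c₁) * (1 - c₂) / (c₁ * c₂) := by
  field_simp

end continuant

end Summit.HodgeConjecture.Ring2AbelianAll.CyclicTransferDeterminant
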